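import Literature.Analysis.UnboundedOperators.WeaklySingularDuhamel
import HarnessLib

/-!
# Shift and concatenation of mild solutions of an abstract semilinear parabolic equation

Analysis/UnboundedOperators support file (everything proved; no definitions, no named facts).  Let `E` be
a real Banach space, `T(t)` (`t ≥ 0`) a strongly continuous semigroup of bounded operators
(`T(s + t) = T(s) T(t)`), `K(t)` (`t > 0`) bounded operators, strongly continuous on `(0, ∞)`, weakly
singular (`‖K(t)‖ ≤ C t^{−α}`, `α < 1`) and intertwined with the semigroup, `K(s + t) = T(s) K(t)` (the
abstract `A^α e^{−tA}` of D. Henry, *Geometric Theory of Semilinear Parabolic Equations*, LNM 840 (1981),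
Thm. 1.4.3), `f ∈ E` a constant forcing and `G : ℝ → E` a continuous inhomogeneity.  The variation of
constants (Duhamel) expression

  `D(t) = T(t) x + ∫₀ᵗ T(t − s) f ds − ∫₀ᵗ K(t − s) G(s) ds`

splits at any intermediate time `0 ≤ a ≤ t` as `D(t) = T(t − a) D(a) + ∫₀^{t−a} T(t − a − s) f ds −
∫₀^{t−a} K(t − a − s) G(a + s) ds` (Henry 1981, proof of Thm. 3.3.4; A. Pazy, *Semigroups of Linear
Operators and Applications to PDE* (1983), §6.3, proof of Thm. 6.3.1, the continuation step):

* `integral_orbit_split` — `∫₀ᵗ T(t − s) f ds = T(t − a) ∫₀ᵃ T(a − s) f ds + ∫₀^{t−a} T(t − a − s) f ds`;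
* `integral_duhamel_split` — `∫₀ᵗ K(t − s) G(s) ds = T(t − a) ∫₀ᵃ K(a − s) G(s) ds +
  ∫₀^{t−a} K(t − a − s) G(a + s) ds`;
* `duhamel_concat` — **concatenation**: a curve `u` satisfying the Duhamel identity from `x` on `[0, a]`
  and the shifted identity from `u(a)` on `[a, b]` satisfies the identity from `x` on `[0, b]`;
* `duhamel_shift` — **shift**: conversely the identity on `[0, b]` gives the shifted identity from
  `u(a)` for `t ↦ u(a + t)` on `[0, b − a]`.

With `G = N(u, u)` these are the restriction / continuation rules for mild solutions of
`y' + Ay = f − N(y, y)` (Henry 1981, Lemma 3.3.2 ff., Thm. 3.3.4); with `f = 0` and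
`G = N(y, w) + N(w, y)` the same rules for the linearised equation.  Deliberately NOT here: existence,
uniqueness, the semigroup as a `C₀`-semigroup structure.

## References

* D. Henry, *Geometric Theory of Semilinear Parabolic Equations*, LNM 840, Springer (1981), Thm. 1.4.3,
  §3.3, Thm. 3.3.4. [Henry1981]
* A. Pazy, *Semigroups of Linear Operators and Applications to Partial Differential Equations*, Springer
  (1983), §6.3, Thm. 6.3.1. [Pazy1983]
-/

open Set Filter MeasureTheory intervalIntegral
open _root_.Topology

namespace Literature.Analysis.UnboundedOperators

variable {E : Type*} [NormedAddCommGroup E] [NormedSpace ℝ E] [CompleteSpace E]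

omit [CompleteSpace E] in
/-- The semigroup law applied to a vector: `T(a + b) x = T(a) (T(b) x)` for `a, b ≥ 0`. [folklore] -/
theorem semigroup_apply_add {T : ℝ → E →L[ℝ] E}
    (hTadd : ∀ s t, 0 ≤ s → 0 ≤ t → T (s + t) = (T s).comp (T t)) {a b : ℝ} (ha : 0 ≤ a)
    (hb : 0 ≤ b) (x : E) : T (a + b) x = T a (T b x) := by
  rw [hTadd a b ha hb, ContinuousLinearMap.comp_apply]

omit [CompleteSpace E] in
/-- The forcing term of a constant forcing after the substitution `u = t − s`:
`∫₀ᵗ T(t − s) f ds = ∫₀ᵗ T(u) f du`. [folklore] -/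
theorem integral_orbit_eq (T : ℝ → E →L[ℝ] E) (f : E) (t : ℝ) :
    ∫ s in (0 : ℝ)..t, T (t - s) f = ∫ u in (0 : ℝ)..t, T u f := by
  rw [intervalIntegral.integral_comp_sub_left (fun u => T u f) t, sub_self, sub_zero]

/-- **Splitting of the forcing term at an intermediate time** (Pazy 1983, §6.3, continuation step of
the proof of Thm. 6.3.1): for a strongly continuous semigroup `T` and `0 ≤ a ≤ t`,
`∫₀ᵗ T(t − s) f ds = T(t − a) ∫₀ᵃ T(a − s) f ds + ∫₀^{t−a} T(t − a − s) f ds`. [folklore] -/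
theorem integral_orbit_split {T : ℝ → E →L[ℝ] E}
    (hTadd : ∀ s t, 0 ≤ s → 0 ≤ t → T (s + t) = (T s).comp (T t))
    (hTc : ∀ y : E, Continuous fun t : ℝ => T t y) (f : E) {a t : ℝ} (ha : 0 ≤ a) (hat : a ≤ t) :
    ∫ s in (0 : ℝ)..t, T (t - s) f =
      T (t - a) (∫ s in (0 : ℝ)..a, T (a - s) f) + ∫ s in (0 : ℝ)..(t - a), T (t - a - s) f := by
  have hint : ∀ b c : ℝ, IntervalIntegrable (fun u => T u f) volume b c := fun b c =>
    (hTc f).intervalIntegrable b c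
  rw [integral_orbit_eq T f t, integral_orbit_eq T f a, integral_orbit_eq T f (t - a),
    ← intervalIntegral.integral_add_adjacent_intervals (hint 0 (t - a)) (hint (t - a) t), add_comm]
  congr 1
  have e : a + (t - a) = t := by ring
  have h1 := intervalIntegral.integral_comp_add_right (fun u => T u f) (t - a) (a := 0) (b := a)
  simp only [zero_add, e] at h1
  rw [← h1]
  have h2 : ∀ v ∈ uIcc 0 a, T (v + (t - a)) f = T (t - a) (T v f) := fun v hv => by
    rw [uIcc_of_le ha] at hv
    rw [add_comm, semigroup_apply_add hTadd (sub_nonneg.2 hat) hv.1]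
  rw [intervalIntegral.integral_congr h2, (T (t - a)).intervalIntegral_comp_comm (hint 0 a)]

/-- **Splitting of the weakly singular Duhamel term at an intermediate time** (Henry 1981, proof of
Thm. 3.3.4; Pazy 1983, §6.3): if `K(s + t) = T(s) K(t)` (`s ≥ 0`, `t > 0`), `‖K(t)‖ ≤ C t^{−α}` with
`α < 1`, `K` is strongly continuous on `(0, ∞)` and `G` is continuous, then for `0 ≤ a ≤ t`
`∫₀ᵗ K(t − s) G(s) ds = T(t − a) ∫₀ᵃ K(a − s) G(s) ds + ∫₀^{t−a} K(t − a − s) G(a + s) ds`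
(on `[0, a)` the kernel factors as `K(t − s) = T(t − a) K(a − s)`, and `T(t − a)` commutes with the
Bochner integral of the integrable Duhamel integrand). [folklore] -/
theorem integral_duhamel_split {T K : ℝ → E →L[ℝ] E} {α C : ℝ} (hα : α < 1)
    (hK : ∀ t, 0 < t → ‖K t‖ ≤ C * t ^ (-α))
    (hKadd : ∀ s t, 0 ≤ s → 0 < t → K (s + t) = (T s).comp (K t))
    (hKc : ∀ y : E, ContinuousOn (fun t : ℝ => K t y) (Ioi 0)) {G : ℝ → E} (hG : Continuous G)
    {a t : ℝ} (ha : 0 ≤ a) (hat : a ≤ t) :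
    ∫ s in (0 : ℝ)..t, K (t - s) (G s) =
      T (t - a) (∫ s in (0 : ℝ)..a, K (a - s) (G s)) +
        ∫ s in (0 : ℝ)..(t - a), K (t - a - s) (G (a + s)) := by
  have ht : 0 ≤ t := ha.trans hat
  have hI : IntervalIntegrable (fun s => K (t - s) (G s)) volume 0 t :=
    intervalIntegrable_duhamelIntegrand hK hKc hα hG ht
  have hI1 : IntervalIntegrable (fun s => K (t - s) (G s)) volume 0 a :=
    hI.mono_set (by rw [uIcc_of_le ha, uIcc_of_le ht]; exact Icc_subset_Icc_right hat)
  have hI2 : IntervalIntegrable (fun s => K (t - s) (G s)) volume a t :=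
    hI.mono_set (by rw [uIcc_of_le hat, uIcc_of_le ht]; exact Icc_subset_Icc_left ha)
  rw [← intervalIntegral.integral_add_adjacent_intervals hI1 hI2]
  congr 1
  · -- the past `[0, a]`: `K(t - s) = T(t - a) K(a - s)` off the endpoint `s = a`
    have hIa : IntervalIntegrable (fun s => K (a - s) (G s)) volume 0 a :=
      intervalIntegrable_duhamelIntegrand hK hKc hα hG ha
    rw [← (T (t - a)).intervalIntegral_comp_comm hIa]
    refine intervalIntegral.integral_congr_ae ?_
    filter_upwards [compl_mem_ae_iff.mpr (Real.volume_singleton (a := a))] with s hsa hs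
    rw [uIoc_of_le ha] at hs
    have hs' : s < a := lt_of_le_of_ne hs.2 hsa
    have e : t - s = (t - a) + (a - s) := by ring
    rw [e, hKadd _ _ (sub_nonneg.2 hat) (sub_pos.2 hs'), ContinuousLinearMap.comp_apply]
  · -- the window `[a, t]`: substitution `s = a + r`
    have h := intervalIntegral.integral_comp_add_right (fun s => K (t - s) (G s)) a (a := 0)
      (b := t - a)
    simp only [zero_add, sub_add_cancel] at h
    rw [← h]
    refine intervalIntegral.integral_congr fun s _ => ?_
    simp only [add_comm s a, sub_add_eq_sub_sub]

/-- **Concatenation of Duhamel identities** (Henry 1981, Thm. 3.3.4, continuation of mild solutions;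
Pazy 1983, Thm. 6.3.1).  If `u(t) = T(t) x + ∫₀ᵗ T(t − s) f ds − ∫₀ᵗ K(t − s) G(s) ds` on `[0, a]` and
`u(t) = T(t − a) u(a) + ∫₀^{t−a} T(t − a − s) f ds − ∫₀^{t−a} K(t − a − s) G(a + s) ds` on `[a, b]`,
then the first identity holds on all of `[0, b]`.  With `G = N(u, u)`: a mild solution on `[0, a]`
continued by a mild solution from `u(a)` is a mild solution on `[0, b]`. [folklore] -/
theorem duhamel_concat {T K : ℝ → E →L[ℝ] E} {α C : ℝ} (hα : α < 1)
    (hTadd : ∀ s t, 0 ≤ s → 0 ≤ t → T (s + t) = (T s).comp (T t))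
    (hTc : ∀ y : E, Continuous fun t : ℝ => T t y) (hK : ∀ t, 0 < t → ‖K t‖ ≤ C * t ^ (-α))
    (hKadd : ∀ s t, 0 ≤ s → 0 < t → K (s + t) = (T s).comp (K t))
    (hKc : ∀ y : E, ContinuousOn (fun t : ℝ => K t y) (Ioi 0)) (f : E) {G : ℝ → E} (hG : Continuous G)
    {u : ℝ → E} {x : E} {a b : ℝ} (ha : 0 ≤ a)
    (h1 : ∀ t ∈ Icc 0 a, u t = T t x + (∫ s in (0 : ℝ)..t, T (t - s) f) -
      ∫ s in (0 : ℝ)..t, K (t - s) (G s))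
    (h2 : ∀ t ∈ Icc a b, u t = T (t - a) (u a) + (∫ s in (0 : ℝ)..(t - a), T (t - a - s) f) -
      ∫ s in (0 : ℝ)..(t - a), K (t - a - s) (G (a + s))) :
    ∀ t ∈ Icc 0 b, u t = T t x + (∫ s in (0 : ℝ)..t, T (t - s) f) -
      ∫ s in (0 : ℝ)..t, K (t - s) (G s) := by
  intro t ht
  rcases le_total t a with hta | hat
  · exact h1 t ⟨ht.1, hta⟩
  have hT : T t x = T (t - a) (T a x) := by
    rw [← semigroup_apply_add hTadd (sub_nonneg.2 hat) ha, sub_add_cancel]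
  rw [h2 t ⟨hat, ht.2⟩, h1 a ⟨ha, le_rfl⟩, integral_orbit_split hTadd hTc f ha hat,
    integral_duhamel_split hα hK hKadd hKc hG ha hat, hT, map_sub, map_add]
  abel

/-- **Shift of a Duhamel identity** (Henry 1981, §3.3; Pazy 1983, §6.3): if
`u(t) = T(t) x + ∫₀ᵗ T(t − s) f ds − ∫₀ᵗ K(t − s) G(s) ds` on `[0, b]` and `0 ≤ a ≤ b`, then
`u(a + t) = T(t) u(a) + ∫₀ᵗ T(t − s) f ds − ∫₀ᵗ K(t − s) G(a + s) ds` on `[0, b − a]`: the time-shift of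
a mild solution is the mild solution from the intermediate value (restriction to `[a, b]`). [folklore] -/
theorem duhamel_shift {T K : ℝ → E →L[ℝ] E} {α C : ℝ} (hα : α < 1)
    (hTadd : ∀ s t, 0 ≤ s → 0 ≤ t → T (s + t) = (T s).comp (T t))
    (hTc : ∀ y : E, Continuous fun t : ℝ => T t y) (hK : ∀ t, 0 < t → ‖K t‖ ≤ C * t ^ (-α))
    (hKadd : ∀ s t, 0 ≤ s → 0 < t → K (s + t) = (T s).comp (K t))
    (hKc : ∀ y : E, ContinuousOn (fun t : ℝ => K t y) (Ioi 0)) (f : E) {G : ℝ → E} (hG : Continuous G)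
    {u : ℝ → E} {x : E} {a b : ℝ} (ha : 0 ≤ a) (hab : a ≤ b)
    (h : ∀ t ∈ Icc 0 b, u t = T t x + (∫ s in (0 : ℝ)..t, T (t - s) f) -
      ∫ s in (0 : ℝ)..t, K (t - s) (G s)) :
    ∀ t ∈ Icc 0 (b - a), u (a + t) = T t (u a) + (∫ s in (0 : ℝ)..t, T (t - s) f) -
      ∫ s in (0 : ℝ)..t, K (t - s) (G (a + s)) := by
  intro t ht
  have hat : a ≤ a + t := le_add_of_nonneg_right ht.1
  have hT : T (a + t) x = T t (T a x) := by
    rw [add_comm, semigroup_apply_add hTadd ht.1 ha]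
  rw [h (a + t) ⟨ha.trans hat, by linarith [ht.2]⟩, h a ⟨ha, hab⟩,
    integral_orbit_split hTadd hTc f ha hat, integral_duhamel_split hα hK hKadd hKc hG ha hat, hT,
    map_sub, map_add]
  simp only [add_sub_cancel_left]
  abel

end Literature.Analysis.UnboundedOperators
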